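import Mathlib.Probability.Moments.Variance
import Mathlib.Probability.Moments.Covariance
import Mathlib.Algebra.QuadraticDiscriminant
import HarnessLib

/-!
# Covariance of bounded variables that oscillate little off rare bad events

Topic `Literature/Probability/Moments`. Elementary second-moment inequalities on a probability
space in the raw-integral form `∫ XY - ∫ X ∫ Y`, as consumed by decoupling estimates for lattice
models in which conditional expectations are controlled only off an exceptional set of boundary
conditions:

* `covariance_sq_le_variance_mul` — **Cauchy–Schwarz for the covariance**,
  `Cov(X, Y)² ≤ Var X · Var Y` (discriminant of `t ↦ E[(t(X − EX) + (Y − EY))²] ≥ 0`);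
* `mem_Icc_sInf_of_osc`, `abs_cov_le_of_osc` — **Popoviciu in oscillation form**: bounded `X`, `Y`
  whose values lie within `a`, resp. `b`, of each other satisfy `|∫ XY − ∫ X ∫ Y| ≤ ab/4`
  (the range of `X` lies in `[inf X, inf X + a]`; Popoviciu 1935, Bhatia–Davis 2000);
* `exists_freeze` — freezing a bounded variable on an event at a good value makes an
  oscillation bound off the event global (and moves integrals by `≤ 2C μ(E)`, proved inline);
* `abs_cov_le_osc` — **two bad events**: `K`-bounded measurable `X`, `Y` with oscillations `≤ a`,
  `≤ b` off events `B₁`, `B₂` of mass `≤ p` have `|∫ XY − ∫ X ∫ Y| ≤ ab/4 + 8K²p`.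

## Mathlib

We USE `ProbabilityTheory.variance_le_sq_of_bounded` (Popoviciu on an interval),
`covariance_eq_sub`, `variance_eq_integral`, `memLp_of_bounded`, `discrim_le_zero`,
`abs_le_of_sq_le_sq`. Mathlib (pinned) has no Cauchy–Schwarz inequality for
`ProbabilityTheory.covariance` (searched `covariance_sq`, `covariance_le`, `abs_covariance`).

## References

* T. Popoviciu, *Sur les équations algébriques ayant toutes leurs racines réelles*, Mathematica
  (Cluj) 9 (1935), 129–145.
* R. Bhatia, C. Davis, *A better bound on the variance*, Amer. Math. Monthly 107 (2000), 353–357.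
* R. Durrett, *Probability: Theory and Examples*, 5th ed. (CUP 2019), §1.6 (Cauchy–Schwarz and
  variance algebra).
-/

noncomputable section

open MeasureTheory ProbabilityTheory

namespace Literature.Probability.Moments

variable {Ω : Type*} [MeasurableSpace Ω] {μ : Measure Ω}

/-! ## Cauchy–Schwarz for the covariance and Popoviciu in oscillation form -/

/-- **Cauchy–Schwarz for the covariance**: `Cov(X, Y)² ≤ Var X · Var Y` for square-integrable
`X`, `Y`, read off the discriminant of `t ↦ E[(t(X − EX) + (Y − EY))²] ≥ 0`
(Durrett 2019, §1.6, Thm. 1.6.5). [folklore] -/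
theorem covariance_sq_le_variance_mul [IsProbabilityMeasure μ] {X Y : Ω → ℝ} (hX : MemLp X 2 μ)
    (hY : MemLp Y 2 μ) : cov[X, Y; μ] ^ 2 ≤ Var[X; μ] * Var[Y; μ] := by
  set F : Ω → ℝ := fun ω => X ω - μ[X] with hF_def
  set G' : Ω → ℝ := fun ω => Y ω - μ[Y] with hG_def
  have hF : MemLp F 2 μ := hX.sub (memLp_const _)
  have hG : MemLp G' 2 μ := hY.sub (memLp_const _)
  have hFF : Integrable (fun ω => F ω * F ω) μ := hF.integrable_mul hF
  have hGG : Integrable (fun ω => G' ω * G' ω) μ := hG.integrable_mul hG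
  have hFG : Integrable (fun ω => F ω * G' ω) μ := hF.integrable_mul hG
  have hcov : cov[X, Y; μ] = ∫ ω, F ω * G' ω ∂μ := rfl
  have hVX : Var[X; μ] = ∫ ω, F ω * F ω ∂μ := by
    rw [variance_eq_integral hX.aestronglyMeasurable.aemeasurable]
    exact integral_congr_ae (ae_of_all _ fun ω => by simp only [hF_def, sq])
  have hVY : Var[Y; μ] = ∫ ω, G' ω * G' ω ∂μ := by
    rw [variance_eq_integral hY.aestronglyMeasurable.aemeasurable]
    exact integral_congr_ae (ae_of_all _ fun ω => by simp only [hG_def, sq])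
  have hquad : ∀ t : ℝ, 0 ≤ (∫ ω, F ω * F ω ∂μ) * (t * t) + (2 * ∫ ω, F ω * G' ω ∂μ) * t +
      ∫ ω, G' ω * G' ω ∂μ := by
    intro t
    have h0 : 0 ≤ ∫ ω, (t * F ω + G' ω) * (t * F ω + G' ω) ∂μ :=
      integral_nonneg fun ω => mul_self_nonneg _
    have e : (fun ω => (t * F ω + G' ω) * (t * F ω + G' ω)) =
        fun ω => (t * t) * (F ω * F ω) + (2 * t) * (F ω * G' ω) + G' ω * G' ω := by
      funext ω; ring
    have hi : Integrable (fun ω => (t * t) * (F ω * F ω) + (2 * t) * (F ω * G' ω)) μ :=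
      (hFF.const_mul _).add (hFG.const_mul _)
    rw [e, integral_add hi hGG, integral_add (hFF.const_mul _) (hFG.const_mul _),
      integral_const_mul, integral_const_mul] at h0
    linarith
  have hd := discrim_le_zero hquad
  rw [discrim] at hd
  rw [hcov, hVX, hVY]
  nlinarith [hd]

omit [MeasurableSpace Ω] in
/-- A bounded real function all of whose values lie within `a` of each other ranges in the
interval `[inf, inf + a]` (the range has diameter `≤ a`). [folklore] -/
theorem mem_Icc_sInf_of_osc {X : Ω → ℝ} {K a : ℝ} (hXK : ∀ ω, |X ω| ≤ K)
    (hosc : ∀ ω ω', |X ω - X ω'| ≤ a) (ω : Ω) :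
    X ω ∈ Set.Icc (sInf (Set.range X)) (sInf (Set.range X) + a) := by
  have hbdd : BddBelow (Set.range X) :=
    ⟨-K, by rintro _ ⟨ω', rfl⟩; exact (abs_le.1 (hXK ω')).1⟩
  refine ⟨csInf_le hbdd ⟨ω, rfl⟩, ?_⟩
  have : X ω - a ≤ sInf (Set.range X) :=
    le_csInf ⟨X ω, ω, rfl⟩ (by rintro _ ⟨ω', rfl⟩; linarith [(abs_le.1 (hosc ω ω')).2])
  linarith

/-- **Popoviciu + Cauchy–Schwarz in oscillation form**: `K`-bounded `X`, `Y` all of whose values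
lie within `a`, resp. `b`, of each other satisfy `|∫ XY − ∫ X ∫ Y| ≤ ab/4` under a probability
measure (Popoviciu 1935: `Var ≤ (range/2)²`; Bhatia–Davis 2000; Durrett 2019, §1.6). [folklore] -/
theorem abs_cov_le_of_osc [IsProbabilityMeasure μ] {X Y : Ω → ℝ} (hXm : AEStronglyMeasurable X μ)
    (hYm : AEStronglyMeasurable Y μ) {K a b : ℝ} (ha : 0 ≤ a) (hb : 0 ≤ b)
    (hXK : ∀ ω, |X ω| ≤ K) (hYK : ∀ ω, |Y ω| ≤ K) (hX : ∀ ω ω', |X ω - X ω'| ≤ a)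
    (hY : ∀ ω ω', |Y ω - Y ω'| ≤ b) :
    |(∫ ω, X ω * Y ω ∂μ) - (∫ ω, X ω ∂μ) * ∫ ω, Y ω ∂μ| ≤ a * b / 4 := by
  have hXI := mem_Icc_sInf_of_osc hXK hX
  have hYI := mem_Icc_sInf_of_osc hYK hY
  have hX2 : MemLp X 2 μ := memLp_of_bounded (ae_of_all _ hXI) hXm 2
  have hY2 : MemLp Y 2 μ := memLp_of_bounded (ae_of_all _ hYI) hYm 2
  have hcov : cov[X, Y; μ] = (∫ ω, X ω * Y ω ∂μ) - (∫ ω, X ω ∂μ) * ∫ ω, Y ω ∂μ := by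
    rw [covariance_eq_sub hX2 hY2]; rfl
  have hVX : Var[X; μ] ≤ (a / 2) ^ 2 := by
    have h := variance_le_sq_of_bounded (ae_of_all _ hXI) hXm.aemeasurable
    rwa [add_sub_cancel_left] at h
  have hVY : Var[Y; μ] ≤ (b / 2) ^ 2 := by
    have h := variance_le_sq_of_bounded (ae_of_all _ hYI) hYm.aemeasurable
    rwa [add_sub_cancel_left] at h
  rw [← hcov]
  refine abs_le_of_sq_le_sq ?_ (by positivity)
  calc cov[X, Y; μ] ^ 2 ≤ Var[X; μ] * Var[Y; μ] := covariance_sq_le_variance_mul hX2 hY2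
    _ ≤ (a / 2) ^ 2 * (b / 2) ^ 2 := mul_le_mul hVX hVY (variance_nonneg _ _) (by positivity)
    _ = (a * b / 4) ^ 2 := by ring

/-! ## Freezing a variable on an event -/

/-- **Freezing at a good value**: a `K`-bounded measurable `X` of oscillation `≤ a` off `B`,
frozen on `B` at `X ω₀` with `ω₀ ∉ B`, is a `K`-bounded measurable modification of oscillation
`≤ a` everywhere, equal to `X` off `B`. [folklore] -/
theorem exists_freeze {X : Ω → ℝ} (hXm : Measurable X) {K a : ℝ} (hXK : ∀ ω, |X ω| ≤ K)
    {B : Set Ω} (hB : MeasurableSet B) (hXa : ∀ ω ω', ω ∉ B → ω' ∉ B → |X ω - X ω'| ≤ a)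
    {ω₀ : Ω} (hω₀ : ω₀ ∉ B) :
    ∃ X' : Ω → ℝ, Measurable X' ∧ (∀ ω, |X' ω| ≤ K) ∧ (∀ ω ω', |X' ω - X' ω'| ≤ a) ∧
      ∀ ω, ω ∉ B → X' ω = X ω := by
  classical
  have hv : ∀ ω, ∃ ω', ω' ∉ B ∧ B.piecewise (fun _ => X ω₀) X ω = X ω' := fun ω => by
    by_cases hω : ω ∈ B
    · exact ⟨ω₀, hω₀, Set.piecewise_eq_of_mem _ _ _ hω⟩
    · exact ⟨ω, hω, Set.piecewise_eq_of_notMem _ _ _ hω⟩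
  refine ⟨B.piecewise (fun _ => X ω₀) X, Measurable.piecewise hB measurable_const hXm,
    fun ω => ?_, fun ω ω' => ?_, fun ω hω => Set.piecewise_eq_of_notMem _ _ _ hω⟩
  · obtain ⟨η, -, h⟩ := hv ω
    rw [h]; exact hXK η
  · obtain ⟨η, hη, h⟩ := hv ω
    obtain ⟨η', hη', h'⟩ := hv ω'
    rw [h, h']; exact hXa η η' hη hη'

/-! ## The covariance bound with two bad events -/

/-- **Covariance of bounded variables oscillating little off rare bad events.** On a probability
space let `X`, `Y` be measurable, `|X|, |Y| ≤ K`, with oscillation `≤ a` (resp. `≤ b`) off a bad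
event `B₁` (resp. `B₂`) of mass `≤ p`. Then `|∫ XY − ∫ X ∫ Y| ≤ ab/4 + 8K²p`: freeze `X` on
`B₁` and `Y` on `B₂` at good values (`exists_freeze`; the three integrals move by `≤ 4K²p`,
`≤ 2Kp`, `≤ 2Kp`), then `abs_cov_le_of_osc` (Popoviciu 1935 + Cauchy–Schwarz; Durrett 2019,
§1.6). [folklore] -/
theorem abs_cov_le_osc [IsProbabilityMeasure μ] {X Y : Ω → ℝ} (hXm : Measurable X)
    (hYm : Measurable Y) {K a b p : ℝ} (hK : 0 ≤ K) (ha : 0 ≤ a) (hb : 0 ≤ b)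
    (hXK : ∀ ω, |X ω| ≤ K) (hYK : ∀ ω, |Y ω| ≤ K)
    {B₁ B₂ : Set Ω} (hB₁ : MeasurableSet B₁) (hB₂ : MeasurableSet B₂)
    (hμ₁ : μ.real B₁ ≤ p) (hμ₂ : μ.real B₂ ≤ p)
    (hXa : ∀ ω ω', ω ∉ B₁ → ω' ∉ B₁ → |X ω - X ω'| ≤ a)
    (hYb : ∀ ω ω', ω ∉ B₂ → ω' ∉ B₂ → |Y ω - Y ω'| ≤ b) :
    |(∫ ω, X ω * Y ω ∂μ) - (∫ ω, X ω ∂μ) * ∫ ω, Y ω ∂μ| ≤ a * b / 4 + 8 * K ^ 2 * p := by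
  have hp : 0 ≤ p := le_trans measureReal_nonneg hμ₁
  have hab : 0 ≤ a * b / 4 := by positivity
  have hmul : ∀ {f g : Ω → ℝ}, (∀ ω, |f ω| ≤ K) → (∀ ω, |g ω| ≤ K) →
      ∀ ω, |f ω * g ω| ≤ K ^ 2 := fun hf hg ω => by
    rw [abs_mul, sq]; exact mul_le_mul (hf ω) (hg ω) (abs_nonneg _) hK
  have hint : ∀ {f : Ω → ℝ} {C : ℝ}, Measurable f → (∀ ω, |f ω| ≤ C) → Integrable f μ :=
    fun hf hC => Integrable.of_bound hf.aestronglyMeasurable _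
      (ae_of_all _ fun ω => by simpa [Real.norm_eq_abs] using hC ω)
  have hIb : ∀ {f : Ω → ℝ} {C : ℝ}, (∀ ω, |f ω| ≤ C) → |∫ ω, f ω ∂μ| ≤ C := fun {f C} hC => by
    have h := norm_integral_le_of_norm_le_const (μ := μ) (f := f) (C := C)
      (ae_of_all _ fun ω => by simpa [Real.norm_eq_abs] using hC ω)
    simpa [Real.norm_eq_abs] using h
  have hIX : |∫ ω, X ω ∂μ| ≤ K := hIb hXK
  -- freezing error: `C`-bounded integrable functions agreeing off `E` have close integrals
  have hfr : ∀ {E : Set Ω} {F F' : Ω → ℝ} {C : ℝ}, MeasurableSet E → (∀ ω, |F ω| ≤ C) →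
      (∀ ω, |F' ω| ≤ C) → (∀ ω, ω ∉ E → F ω = F' ω) → Integrable F μ → Integrable F' μ →
      |(∫ ω, F ω ∂μ) - ∫ ω, F' ω ∂μ| ≤ 2 * C * μ.real E := by
    intro E F F' C hE hF hF' heq hFi hF'i
    rw [← integral_sub hFi hF'i]
    have hbound : ∀ ω, ‖F ω - F' ω‖ ≤ E.indicator (fun _ => 2 * C) ω := fun ω => by
      by_cases hω : ω ∈ E
      · rw [Set.indicator_of_mem hω, Real.norm_eq_abs]
        calc |F ω - F' ω| ≤ |F ω| + |F' ω| := abs_sub _ _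
          _ ≤ C + C := add_le_add (hF ω) (hF' ω)
          _ = 2 * C := by ring
      · rw [Set.indicator_of_notMem hω, heq ω hω, sub_self, norm_zero]
    calc |∫ ω, (F ω - F' ω) ∂μ| = ‖∫ ω, (F ω - F' ω) ∂μ‖ := (Real.norm_eq_abs _).symm
      _ ≤ ∫ ω, E.indicator (fun _ => 2 * C) ω ∂μ :=
          norm_integral_le_of_norm_le ((integrable_const _).indicator hE) (ae_of_all _ hbound)
      _ = 2 * C * μ.real E := by rw [integral_indicator_const _ hE, smul_eq_mul, mul_comm]
  by_cases hne : (∃ ω₁, ω₁ ∉ B₁) ∧ (∃ ω₂, ω₂ ∉ B₂)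
  swap
  · -- a bad event is everything: `1 ≤ p`, and the trivial bound `2K²` suffices
    have hp1 : 1 ≤ p := by
      rcases not_and_or.1 hne with h | h
      · push Not at h
        rw [Set.eq_univ_of_forall h, probReal_univ] at hμ₁; exact hμ₁
      · push Not at h
        rw [Set.eq_univ_of_forall h, probReal_univ] at hμ₂; exact hμ₂
    have h1 : |∫ ω, X ω * Y ω ∂μ| ≤ K ^ 2 := hIb (hmul hXK hYK)
    have h2 : |(∫ ω, X ω ∂μ) * ∫ ω, Y ω ∂μ| ≤ K * K := by
      rw [abs_mul]; exact mul_le_mul hIX (hIb hYK) (abs_nonneg _) hK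
    calc _ ≤ |∫ ω, X ω * Y ω ∂μ| + |(∫ ω, X ω ∂μ) * ∫ ω, Y ω ∂μ| := abs_sub _ _
      _ ≤ K ^ 2 + K * K := add_le_add h1 h2
      _ ≤ a * b / 4 + 8 * K ^ 2 * p := by nlinarith [sq_nonneg K]
  obtain ⟨⟨ω₁, hω₁⟩, ⟨ω₂, hω₂⟩⟩ := hne
  obtain ⟨X', hX'm, hX'K, hX'osc, hoffX⟩ := exists_freeze hXm hXK hB₁ hXa hω₁
  obtain ⟨Y', hY'm, hY'K, hY'osc, hoffY⟩ := exists_freeze hYm hYK hB₂ hYb hω₂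
  -- the frozen covariance and the three freezing errors
  have hcov := abs_cov_le_of_osc (μ := μ) hX'm.aestronglyMeasurable hY'm.aestronglyMeasurable
    ha hb hX'K hY'K hX'osc hY'osc
  have hd1 : |(∫ ω, X' ω * Y' ω ∂μ) - ∫ ω, X ω * Y ω ∂μ| ≤ 2 * K ^ 2 * μ.real (B₁ ∪ B₂) :=
    hfr (hB₁.union hB₂) (hmul hX'K hY'K) (hmul hXK hYK)
      (fun ω hω => by
        rw [hoffX ω fun h => hω (Set.mem_union_left _ h),
          hoffY ω fun h => hω (Set.mem_union_right _ h)])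
      (hint (hX'm.mul hY'm) (hmul hX'K hY'K)) (hint (hXm.mul hYm) (hmul hXK hYK))
  have hd2 : |(∫ ω, X' ω ∂μ) - ∫ ω, X ω ∂μ| ≤ 2 * K * μ.real B₁ :=
    hfr hB₁ hX'K hXK hoffX (hint hX'm hX'K) (hint hXm hXK)
  have hd3 : |(∫ ω, Y' ω ∂μ) - ∫ ω, Y ω ∂μ| ≤ 2 * K * μ.real B₂ :=
    hfr hB₂ hY'K hYK hoffY (hint hY'm hY'K) (hint hYm hYK)
  have hU : μ.real (B₁ ∪ B₂) ≤ p + p := (measureReal_union_le _ _).trans (add_le_add hμ₁ hμ₂)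
  have h2 : |(∫ ω, X' ω * Y' ω ∂μ) - ∫ ω, X ω * Y ω ∂μ| ≤ 2 * K ^ 2 * (p + p) :=
    hd1.trans (mul_le_mul_of_nonneg_left hU (by positivity))
  have h3 : |((∫ ω, X' ω ∂μ) - ∫ ω, X ω ∂μ) * ∫ ω, Y' ω ∂μ| ≤ 2 * K * p * K := by
    rw [abs_mul]
    exact mul_le_mul (hd2.trans (mul_le_mul_of_nonneg_left hμ₁ (by positivity)))
      (hIb hY'K) (abs_nonneg _) (by positivity)
  have h4 : |(∫ ω, X ω ∂μ) * ((∫ ω, Y' ω ∂μ) - ∫ ω, Y ω ∂μ)| ≤ K * (2 * K * p) := by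
    rw [abs_mul]
    exact mul_le_mul hIX (hd3.trans (mul_le_mul_of_nonneg_left hμ₂ (by positivity)))
      (abs_nonneg _) hK
  have e : (∫ ω, X ω * Y ω ∂μ) - (∫ ω, X ω ∂μ) * ∫ ω, Y ω ∂μ =
      ((∫ ω, X' ω * Y' ω ∂μ) - (∫ ω, X' ω ∂μ) * ∫ ω, Y' ω ∂μ) -
        ((∫ ω, X' ω * Y' ω ∂μ) - ∫ ω, X ω * Y ω ∂μ) +
        ((∫ ω, X' ω ∂μ) - ∫ ω, X ω ∂μ) * (∫ ω, Y' ω ∂μ) +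
        (∫ ω, X ω ∂μ) * ((∫ ω, Y' ω ∂μ) - ∫ ω, Y ω ∂μ) := by ring
  rw [e, abs_le]
  rw [abs_le] at hcov h2 h3 h4
  constructor <;> linarith [hcov.1, hcov.2, h2.1, h2.2, h3.1, h3.2, h4.1, h4.2]

end Literature.Probability.Moments

end
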